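import Summits.AtomisticToContinuum.Crystallization.Theses.ChessboardParticlePlanes
import Summits.AtomisticToContinuum.Crystallization.Theorems.ChessboardParticlePlanesLjPlaneChessboardYukawaSlicing

/-!
# Crux `ChessboardParticlePlanes.LjPlaneChessboard` (stmt-AtomisticToContinuum-6709), line `Sketch`,
# stub `ljSliceSwap` — swapping the layer sum with the Yukawa slicing integral

For a family of distances `R i ≥ z > 0` (the 3-D distances from a point to the points of another
layer) with `Σ_i R_i⁻⁶ < ∞`, the Lennard-Jones cross-layer energy `Σ_i V_LJ(R_i)` is the integral
over Yukawa masses `m > 0` of the slice sums `Σ_i e^{-m R_i}/R_i` against the slicing density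
`ω(m) = m¹⁰/43545600 - m⁴/144` of `stub_yukawaSlicing`:
`Σ_i V_LJ(R_i) = ∫₀^∞ ω(m) · Σ_i e^{-m R_i}/R_i dm`,
together with all the summability / integrability facts this needs.  This is Fubini–Tonelli for
the counting measure on `ι` times Lebesgue measure on `(0, ∞)`: the absolute majorant
`|ω(m)| e^{-mR}/R ≤ (m¹⁰/43545600 + m⁴/144) e^{-mR}/R` integrates (Euler's integral
`∫₀^∞ mⁿ e^{-mR} dm = n!/Rⁿ⁺¹`) to `(1/12) R⁻¹² + (1/6) R⁻⁶ ≤ (z⁻⁶/12 + 1/6) R⁻⁶`, which is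
summable in `i`.  The index type `ι` is arbitrary: a summable family of *strictly positive* reals
has countable index type (`Summable.countable_support`), which is what Mathlib's series form of
dominated convergence (`MeasureTheory.integral_tsum_of_summable_integral_norm`) requires.

Main results:
* `integrable_tsum_of_summable_integral_norm` : a series of integrable functions with summable
  `L¹` norms has an integrable sum (the integrability companion of Mathlib's
  `MeasureTheory.integral_tsum_of_summable_integral_norm`);
* `summable_lennardJones_of_le`, `summable_yukawaSlice_of_le` : the two summability facts;
* `ljSliceSwap` : the registered stub.
[folklore]
-/

noncomputable section

namespace Summit.AtomisticToContinuum.Crystallization.Theorems.ChessboardParticlePlanesLjPlaneChessboard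

open Literature.MathematicalPhysics.StatisticalMechanics MeasureTheory Filter
open scoped Topology ENNReal

/-! ## Integrability of a series with summable `L¹` norms -/

/-- A series `Σ_i F_i` of integrable functions over a countable index type with summable `L¹`
norms `Σ_i ∫ ‖F_i‖ < ∞` has an integrable sum `a ↦ Σ'_i F_i a`: the sum is a.e. the limit of the
finite partial sums (the norms are a.e. summable, `summable_norm_of_tsum_eLpNorm_ne_top`), hence
a.e.-strongly measurable, and `∫⁻ ‖Σ'_i F_i‖ ≤ Σ_i ∫⁻ ‖F_i‖ < ∞` by Tonelli for series.
[folklore] -/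
theorem integrable_tsum_of_summable_integral_norm {α : Type*} [MeasurableSpace α]
    {μ : Measure α} {ι : Type*} [Countable ι] {F : ι → α → ℝ}
    (hF_int : ∀ i, Integrable (F i) μ) (hF_sum : Summable fun i => ∫ a, ‖F i a‖ ∂μ) :
    Integrable (fun a => ∑' i, F i a) μ := by
  classical
  have h1 : (fun i => ∫⁻ a, ‖F i a‖ₑ ∂μ) = fun i => ENNReal.ofReal (∫ a, ‖F i a‖ ∂μ) :=
    funext fun i => (ofReal_integral_norm_eq_lintegral_enorm (hF_int i)).symm
  have hne : ∑' i, ∫⁻ a, ‖F i a‖ₑ ∂μ ≠ ∞ := by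
    rw [h1, ← ENNReal.ofReal_tsum_of_nonneg
      (fun i => integral_nonneg fun a => norm_nonneg (F i a)) hF_sum]
    exact ENNReal.ofReal_ne_top
  have hS : ∀ᵐ a ∂μ, Summable fun i => ‖F i a‖ := by
    refine summable_norm_of_tsum_eLpNorm_ne_top le_rfl (fun i => (hF_int i).1) ?_
    simpa only [eLpNorm_one_eq_lintegral_enorm] using hne
  have hmeas : AEStronglyMeasurable (fun a => ∑' i, F i a) μ := by
    refine aestronglyMeasurable_of_tendsto_ae (atTop : Filter (Finset ι))
      (f := fun s a => ∑ i ∈ s, F i a) (fun s => ?_) ?_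
    · exact Finset.aestronglyMeasurable_fun_sum s fun i _ => (hF_int i).1
    · filter_upwards [hS] with a ha using ha.of_norm.hasSum
  have hle : ∫⁻ a, ‖∑' i, F i a‖ₑ ∂μ ≤ ∑' i, ∫⁻ a, ‖F i a‖ₑ ∂μ :=
    calc ∫⁻ a, ‖∑' i, F i a‖ₑ ∂μ ≤ ∫⁻ a, ∑' i, ‖F i a‖ₑ ∂μ :=
          lintegral_mono fun a => enorm_tsum_le_tsum_enorm
      _ = ∑' i, ∫⁻ a, ‖F i a‖ₑ ∂μ := lintegral_tsum fun i => (hF_int i).1.enorm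
  exact ⟨hmeas, lt_of_le_of_lt hle hne.lt_top⟩

/-! ## Pointwise bounds: everything is dominated by a multiple of `R⁻⁶` -/

/-- For `0 < z ≤ r`: `(1/12) r⁻¹² + (1/6) r⁻⁶ ≤ (z⁻⁶/12 + 1/6) r⁻⁶` (`r⁻¹² = r⁻⁶ · r⁻⁶ ≤ z⁻⁶ r⁻⁶`).
[folklore] -/
theorem ljMajorant_le {z r : ℝ} (hz : 0 < z) (hzr : z ≤ r) :
    1 / 12 * r⁻¹ ^ 12 + 1 / 6 * r⁻¹ ^ 6 ≤ (z⁻¹ ^ 6 / 12 + 1 / 6) * r⁻¹ ^ 6 := by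
  have h0 : 0 ≤ r⁻¹ := inv_nonneg.2 (hz.le.trans hzr)
  have h6 : r⁻¹ ^ 6 ≤ z⁻¹ ^ 6 := pow_le_pow_left₀ h0 (inv_anti₀ hz hzr) 6
  have hu : 0 ≤ r⁻¹ ^ 6 := pow_nonneg h0 6
  have h12 : r⁻¹ ^ 12 = r⁻¹ ^ 6 * r⁻¹ ^ 6 := by ring
  rw [h12]
  nlinarith [mul_le_mul_of_nonneg_right h6 hu]

/-- For `0 < z ≤ r`: `|V_LJ(r)| ≤ (1/12) r⁻¹² + (1/6) r⁻⁶ ≤ (z⁻⁶/12 + 1/6) r⁻⁶`. [folklore] -/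
theorem abs_lennardJones_le {z r : ℝ} (hz : 0 < z) (hzr : z ≤ r) :
    |lennardJones r| ≤ (z⁻¹ ^ 6 / 12 + 1 / 6) * r⁻¹ ^ 6 := by
  refine le_trans ?_ (ljMajorant_le hz hzr)
  have h0 : 0 ≤ r⁻¹ := inv_nonneg.2 (hz.le.trans hzr)
  have ha : 0 ≤ 1 / 12 * r⁻¹ ^ 12 := by positivity
  have hb : 0 ≤ 1 / 6 * r⁻¹ ^ 6 := by positivity
  unfold lennardJones
  exact abs_sub_le_iff.2 ⟨by linarith, by linarith⟩

/-- For `0 < z ≤ r` and `m > 0`: `e^{-mr}/r ≤ (720/(m⁶ z)) · r⁻⁶`, from `x⁶/6! ≤ eˣ` at `x = mr`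
(`Real.pow_div_factorial_le_exp`) and `1/r ≤ 1/z`. [folklore] -/
theorem exp_neg_mul_div_le {z r m : ℝ} (hz : 0 < z) (hzr : z ≤ r) (hm : 0 < m) :
    Real.exp (-(m * r)) / r ≤ 720 / (m ^ 6 * z) * r⁻¹ ^ 6 := by
  have hr : 0 < r := hz.trans_le hzr
  have hx : 0 < m * r := mul_pos hm hr
  have hfac := Real.pow_div_factorial_le_exp (m * r) hx.le 6
  have h720 : ((Nat.factorial 6 : ℕ) : ℝ) = 720 := by norm_num [Nat.factorial]
  rw [h720] at hfac
  have hexp : Real.exp (-(m * r)) ≤ 720 / (m * r) ^ 6 := by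
    rw [Real.exp_neg]
    calc (Real.exp (m * r))⁻¹ ≤ ((m * r) ^ 6 / 720)⁻¹ := inv_anti₀ (by positivity) hfac
      _ = 720 / (m * r) ^ 6 := by rw [inv_div]
  calc Real.exp (-(m * r)) / r ≤ (720 / (m * r) ^ 6) / z :=
        div_le_div₀ (by positivity) hexp hz hzr
    _ = 720 / (m ^ 6 * z) * r⁻¹ ^ 6 := by
        field_simp

/-! ## The two summability facts -/

/-- `Σ_i V_LJ(R_i)` converges (absolutely) when `R_i ≥ z > 0` and `Σ_i R_i⁻⁶ < ∞`, by comparison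
with `(z⁻⁶/12 + 1/6) R_i⁻⁶` (`abs_lennardJones_le`). [folklore] -/
theorem summable_lennardJones_of_le {ι : Type*} {R : ι → ℝ} {z : ℝ} (hz : 0 < z)
    (hR : ∀ i, z ≤ R i) (hS : Summable fun i => (R i)⁻¹ ^ 6) :
    Summable fun i => lennardJones (R i) :=
  Summable.of_norm_bounded (hS.mul_left (z⁻¹ ^ 6 / 12 + 1 / 6)) fun i => by
    rw [Real.norm_eq_abs]
    exact abs_lennardJones_le hz (hR i)

/-- The Yukawa slice sum `Σ_i e^{-m R_i}/R_i` converges for every mass `m > 0` when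
`R_i ≥ z > 0` and `Σ_i R_i⁻⁶ < ∞`, by comparison with `(720/(m⁶ z)) R_i⁻⁶` (`exp_neg_mul_div_le`).
[folklore] -/
theorem summable_yukawaSlice_of_le {ι : Type*} {R : ι → ℝ} {z : ℝ} (hz : 0 < z)
    (hR : ∀ i, z ≤ R i) (hS : Summable fun i => (R i)⁻¹ ^ 6) {m : ℝ} (hm : 0 < m) :
    Summable fun i => Real.exp (-(m * R i)) / R i :=
  Summable.of_nonneg_of_le (fun i => div_nonneg (Real.exp_nonneg _) (hz.le.trans (hR i)))
    (fun i => exp_neg_mul_div_le hz (hR i) hm) (hS.mul_left (720 / (m ^ 6 * z)))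

/-! ## The sliced terms: integrability and `L¹` norms -/

/-- Splitting `(m¹⁰/43545600 ± m⁴/144) · e^{-mr}/r` into the two Euler integrands. [folklore] -/
theorem sliceTerm_split (r : ℝ) (hr : 0 < r) (s : ℝ) :
    (fun m : ℝ => (m ^ 10 / 43545600 + s * (m ^ 4 / 144)) * (Real.exp (-(m * r)) / r)) =
      fun m : ℝ => 1 / (43545600 * r) * (m ^ 10 * Real.exp (-(m * r))) +
        s / (144 * r) * (m ^ 4 * Real.exp (-(m * r))) := by
  funext m
  field_simp

/-- The sliced term `ω(m) e^{-mr}/r`, `ω(m) = m¹⁰/43545600 - m⁴/144`, is integrable on `(0, ∞)`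
for `r > 0`. [folklore] -/
theorem integrableOn_sliceTerm {r : ℝ} (hr : 0 < r) :
    IntegrableOn (fun m : ℝ => (m ^ 10 / 43545600 - m ^ 4 / 144) * (Real.exp (-(m * r)) / r))
      (Set.Ioi 0) := by
  have i10 := (integrableOn_pow_mul_exp_neg_mul_Ioi 10 hr).const_mul (1 / (43545600 * r))
  have i4 := (integrableOn_pow_mul_exp_neg_mul_Ioi 4 hr).const_mul ((-1) / (144 * r))
  have h := sliceTerm_split r hr (-1)
  simp only [neg_one_mul, ← sub_eq_add_neg] at h
  rw [h]
  exact i10.add i4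

/-- The absolute majorant `(m¹⁰/43545600 + m⁴/144) e^{-mr}/r` is integrable on `(0, ∞)` for
`r > 0`. [folklore] -/
theorem integrableOn_sliceMajorant {r : ℝ} (hr : 0 < r) :
    IntegrableOn (fun m : ℝ => (m ^ 10 / 43545600 + m ^ 4 / 144) * (Real.exp (-(m * r)) / r))
      (Set.Ioi 0) := by
  have i10 := (integrableOn_pow_mul_exp_neg_mul_Ioi 10 hr).const_mul (1 / (43545600 * r))
  have i4 := (integrableOn_pow_mul_exp_neg_mul_Ioi 4 hr).const_mul (1 / (144 * r))
  have h := sliceTerm_split r hr 1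
  simp only [one_mul] at h
  rw [h]
  exact i10.add i4

/-- Euler's integral evaluates the majorant:
`∫₀^∞ (m¹⁰/43545600 + m⁴/144) e^{-mr}/r dm = (1/12) r⁻¹² + (1/6) r⁻⁶` (`10!/43545600 = 1/12`,
`4!/144 = 1/6`). [folklore] -/
theorem integral_sliceMajorant {r : ℝ} (hr : 0 < r) :
    ∫ m in Set.Ioi (0 : ℝ), (m ^ 10 / 43545600 + m ^ 4 / 144) * (Real.exp (-(m * r)) / r) =
      1 / 12 * r⁻¹ ^ 12 + 1 / 6 * r⁻¹ ^ 6 := by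
  have i10 := (integrableOn_pow_mul_exp_neg_mul_Ioi 10 hr).const_mul (1 / (43545600 * r))
  have i4 := (integrableOn_pow_mul_exp_neg_mul_Ioi 4 hr).const_mul (1 / (144 * r))
  have h := sliceTerm_split r hr 1
  simp only [one_mul] at h
  rw [h, integral_add i10 i4, integral_const_mul, integral_const_mul,
    integral_pow_mul_exp_neg_mul_Ioi 10 hr, integral_pow_mul_exp_neg_mul_Ioi 4 hr]
  simp only [Nat.factorial, Nat.succ_eq_add_one]
  push_cast
  field_simp
  ring

/-- The sliced term is dominated by the majorant: `|ω(m)| e^{-mr}/r ≤ (m¹⁰/43545600 + m⁴/144)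
e^{-mr}/r` (`r > 0`; `m¹⁰, m⁴ ≥ 0` for every real `m`). [folklore] -/
theorem norm_sliceTerm_le {r : ℝ} (hr : 0 < r) (m : ℝ) :
    ‖(m ^ 10 / 43545600 - m ^ 4 / 144) * (Real.exp (-(m * r)) / r)‖ ≤
      (m ^ 10 / 43545600 + m ^ 4 / 144) * (Real.exp (-(m * r)) / r) := by
  rw [Real.norm_eq_abs, abs_mul, abs_of_nonneg (div_nonneg (Real.exp_nonneg _) hr.le)]
  refine mul_le_mul_of_nonneg_right ?_ (div_nonneg (Real.exp_nonneg _) hr.le)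
  have ha : 0 ≤ m ^ 10 / 43545600 := by positivity
  have hb : 0 ≤ m ^ 4 / 144 := by positivity
  exact abs_sub_le_iff.2 ⟨by linarith, by linarith⟩

/-- The `L¹((0,∞))` norm of the sliced term is at most `(z⁻⁶/12 + 1/6) r⁻⁶` for `0 < z ≤ r`.
[folklore] -/
theorem integral_norm_sliceTerm_le {z r : ℝ} (hz : 0 < z) (hzr : z ≤ r) :
    ∫ m in Set.Ioi (0 : ℝ), ‖(m ^ 10 / 43545600 - m ^ 4 / 144) * (Real.exp (-(m * r)) / r)‖ ≤
      (z⁻¹ ^ 6 / 12 + 1 / 6) * r⁻¹ ^ 6 := by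
  have hr : 0 < r := hz.trans_le hzr
  refine le_trans ?_ ((integral_sliceMajorant hr).le.trans (ljMajorant_le hz hzr))
  exact integral_mono (integrableOn_sliceTerm hr).norm (integrableOn_sliceMajorant hr)
    fun m => norm_sliceTerm_le hr m

/-! ## The registered stub -/

/-- **Stub `ljSliceSwap` — the layer sum commutes with the Yukawa slicing integral.**
For distances `R i ≥ z > 0` with `Σ_i R_i⁻⁶ < ∞`:
(i) `Σ_i V_LJ(R_i)` converges; (ii) every Yukawa slice sum `Σ_i e^{-m R_i}/R_i` (`m > 0`)
converges; (iii) `m ↦ ω(m) Σ_i e^{-m R_i}/R_i` is integrable on `(0, ∞)`,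
`ω(m) = m¹⁰/43545600 - m⁴/144`; (iv) `Σ_i V_LJ(R_i) = ∫₀^∞ ω(m) Σ_i e^{-m R_i}/R_i dm`.
Proof: termwise `V_LJ(R_i) = ∫₀^∞ ω(m) e^{-m R_i}/R_i dm` (`stub_yukawaSlicing`); the `L¹` norms
`∫₀^∞ |ω(m)| e^{-m R_i}/R_i dm ≤ (z⁻⁶/12 + 1/6) R_i⁻⁶` are summable, so dominated convergence for
series (`MeasureTheory.integral_tsum_of_summable_integral_norm`, over the countable index type
forced by `Summable.countable_support`) swaps `Σ_i` and `∫ dm`, and `ω(m)` is pulled out of the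
inner sum by `tsum_mul_left`. [folklore] -/
theorem ljSliceSwap :
    ∀ (ι : Type) (R : ι → ℝ) (z : ℝ), 0 < z → (∀ i, z ≤ R i) → Summable (fun i => (R i)⁻¹ ^ 6) →
      Summable (fun i => lennardJones (R i)) ∧
      (∀ m : ℝ, 0 < m → Summable (fun i => Real.exp (-(m * R i)) / R i)) ∧
      MeasureTheory.IntegrableOn
        (fun m : ℝ => (m ^ 10 / 43545600 - m ^ 4 / 144) * ∑' i, Real.exp (-(m * R i)) / R i)
        (Set.Ioi 0) ∧
      ∑' i, lennardJones (R i) =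
        ∫ m in Set.Ioi (0 : ℝ), (m ^ 10 / 43545600 - m ^ 4 / 144) * ∑' i, Real.exp (-(m * R i)) / R i := by
  intro ι R z hz hR hS
  have hRpos : ∀ i, 0 < R i := fun i => hz.trans_le (hR i)
  -- a summable family of strictly positive reals has countable index type
  haveI : Countable ι := Set.countable_univ_iff.1
    (hS.countable_support.mono fun i _ =>
      Function.mem_support.2 (pow_pos (inv_pos.2 (hRpos i)) 6).ne')
  -- the sliced family `F i m = ω(m) e^{-m R_i}/R_i` on `(0, ∞)`
  set F : ι → ℝ → ℝ := fun i m =>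
    (m ^ 10 / 43545600 - m ^ 4 / 144) * (Real.exp (-(m * R i)) / R i) with hF
  have hF_int : ∀ i, Integrable (F i) (volume.restrict (Set.Ioi 0)) := fun i =>
    integrableOn_sliceTerm (hRpos i)
  have hF_sum : Summable fun i => ∫ m in Set.Ioi (0 : ℝ), ‖F i m‖ :=
    Summable.of_nonneg_of_le (fun i => integral_nonneg fun m => norm_nonneg _)
      (fun i => integral_norm_sliceTerm_le hz (hR i)) (hS.mul_left (z⁻¹ ^ 6 / 12 + 1 / 6))
  have hswap := integral_tsum_of_summable_integral_norm hF_int hF_sum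
  have hint := integrable_tsum_of_summable_integral_norm hF_int hF_sum
  have hfun : (fun m : ℝ => ∑' i, F i m) =
      fun m : ℝ => (m ^ 10 / 43545600 - m ^ 4 / 144) * ∑' i, Real.exp (-(m * R i)) / R i := by
    funext m
    exact tsum_mul_left
  refine ⟨summable_lennardJones_of_le hz hR hS, fun m hm => summable_yukawaSlice_of_le hz hR hS hm,
    ?_, ?_⟩
  · rw [← hfun]
    exact hint
  · rw [← hfun, ← hswap]
    exact tsum_congr fun i => stub_yukawaSlicing (R i) (hRpos i)

end Summit.AtomisticToContinuum.Crystallization.Theorems.ChessboardParticlePlanesLjPlaneChessboard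

end
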